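import Summits.NavierStokesRegularity.NavierStokesRegularity.Theses.RellichScar
import Summits.NavierStokesRegularity.NavierStokesRegularity.Theorems.RellichScarSymmetricScarExistsRotWindowRigidity
import Literature.Analysis.FluidPDE.AncientLimitVanishingScaled
import HarnessLib

/-!
# `ScarRigidity` — line `SketchIdeator6` (generator–hull): GLUE lemmas of the reduction
# (crux stmt-NavierStokesRegularity-11717, route RellichScar; lead a3)

Sorry-free plumbing used by the line's composition (`…GeneratorHullReduction.lean`):

* `ae_nsRescale_congr`, `ae_conj_congr` — a.e. equality on the open backward slab `(−∞,0) × ℝ³` is transported by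
  the parabolic rescaling `nsRescale λ` (`λ > 0`; quasi-measure-preserving dilation) and by rotation-conjugation
  `(t,x) ↦ R_θ u(t, R_{−θ}x)` (measure-preserving);
* `continuousOn_uncurry_nsRescale`, `continuousOn_uncurry_conj` — the transformed fields stay continuous on the slab;
* `eq_on_slab_of_ae_eq` — two fields continuous on the slab and a.e. equal there agree on the slab;
* `selfSimilar_of_window` — EXACT self-similarity for all `λ` in a neighbourhood of `1` gives it for every `λ > 0`
  (the log-stabiliser is an open subgroup of the connected group `ℝ`);
* `axisymmetric_of_window` — EXACT invariance under rotation-conjugation for small angles gives it for all angles.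

Closes with the registered tools stub `stub_generatorHullGlue` (conjunction), so that it lands `--supports` the item.
-/

noncomputable section

open Set Filter Function MeasureTheory Metric TopologicalSpace
open scoped Topology ENNReal NNReal InnerProductSpace RealInnerProductSpace

set_option linter.dupNamespace false -- D-0017: `Summit.<S>.<S>.…` repeats the summit name by design

namespace Summit.NavierStokesRegularity.NavierStokesRegularity.Theorems.RellichScarScarRigidity

open Literature.Analysis.FluidPDE
open Summit.NavierStokesRegularity.NavierStokesRegularity.Theses.RellichScar

/-- Physical space. -/
local notation "ℝ³" => EuclideanSpace ℝ (Fin 3)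

/-- The open backward slab `(-∞,0) × ℝ³`. -/
local notation "𝕊" => Literature.Analysis.FluidPDE.slab (EuclideanSpace ℝ (Fin 3)) (Set.Iio (0 : ℝ)) isOpen_Iio

namespace GeneratorHull

/-- The slab `(−∞,0) × ℝ³` is open. -/
theorem isOpen_slabSet : IsOpen (Iio (0 : ℝ) ×ˢ (univ : Set ℝ³)) := isOpen_Iio.prod isOpen_univ

/-- The slab `(−∞,0) × ℝ³` is measurable. -/
theorem measurableSet_slabSet : MeasurableSet (Iio (0 : ℝ) ×ˢ (univ : Set ℝ³)) :=
  measurableSet_Iio.prod MeasurableSet.univ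

/-- The weight `(−t)/(‖x‖+√(−t))³` is positive on the slab. -/
theorem weight_pos {t : ℝ} (ht : t < 0) (x : ℝ³) : 0 < (-t) / (‖x‖ + Real.sqrt (-t)) ^ 3 := by
  have hnt : 0 < -t := by linarith
  have hs : 0 < Real.sqrt (-t) := Real.sqrt_pos.2 hnt
  have hden : 0 < ‖x‖ + Real.sqrt (-t) := add_pos_of_nonneg_of_pos (norm_nonneg _) hs
  exact div_pos hnt (pow_pos hden 3)

/-- Continuity of a rescaled field on the slab. -/
theorem continuousOn_uncurry_nsRescale {V : ℝ → ℝ³ → ℝ³}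
    (hV : ContinuousOn (uncurry V) (Iio (0 : ℝ) ×ˢ (univ : Set ℝ³))) {lam : ℝ} (hlam : 0 < lam) :
    ContinuousOn (uncurry (nsRescale lam V)) (Iio (0 : ℝ) ×ˢ (univ : Set ℝ³)) := by
  have hΦ : Continuous fun z : ℝ × ℝ³ => ((lam ^ 2 * z.1, lam • z.2) : ℝ × ℝ³) := by fun_prop
  have hmaps : MapsTo (fun z : ℝ × ℝ³ => ((lam ^ 2 * z.1, lam • z.2) : ℝ × ℝ³))
      (Iio (0 : ℝ) ×ˢ (univ : Set ℝ³)) (Iio (0 : ℝ) ×ˢ (univ : Set ℝ³)) := fun z hz =>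
    ⟨show lam ^ 2 * z.1 < 0 from mul_neg_of_pos_of_neg (pow_pos hlam 2) hz.1, mem_univ _⟩
  refine ((hV.comp hΦ.continuousOn hmaps).const_smul lam).congr ?_
  rintro ⟨s, y⟩ -
  simp [nsRescale_apply]

/-- Continuity of a rotation-conjugated field on the slab. -/
theorem continuousOn_uncurry_conj {V : ℝ → ℝ³ → ℝ³}
    (hV : ContinuousOn (uncurry V) (Iio (0 : ℝ) ×ˢ (univ : Set ℝ³))) (θ : ℝ) :
    ContinuousOn (uncurry fun t x => rotZ θ (V t (rotZ (-θ) x))) (Iio (0 : ℝ) ×ˢ (univ : Set ℝ³)) := by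
  have hΦ : Continuous fun z : ℝ × ℝ³ => ((z.1, rotZ (-θ) z.2) : ℝ × ℝ³) :=
    continuous_fst.prodMk ((rotZLIE (-θ)).continuous.comp continuous_snd)
  have hmaps : MapsTo (fun z : ℝ × ℝ³ => ((z.1, rotZ (-θ) z.2) : ℝ × ℝ³))
      (Iio (0 : ℝ) ×ˢ (univ : Set ℝ³)) (Iio (0 : ℝ) ×ˢ (univ : Set ℝ³)) := fun z hz =>
    ⟨hz.1, mem_univ _⟩
  have h1 : ContinuousOn (fun z : ℝ × ℝ³ => rotZ θ (uncurry V (z.1, rotZ (-θ) z.2)))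
      (Iio (0 : ℝ) ×ˢ (univ : Set ℝ³)) :=
    (rotZLIE θ).continuous.comp_continuousOn (hV.comp hΦ.continuousOn hmaps)
  refine h1.congr ?_
  rintro ⟨s, y⟩ -
  simp [uncurry]

/-- A.e. equality on the slab is transported by the parabolic rescaling. -/
theorem ae_nsRescale_congr {u V : ℝ → ℝ³ → ℝ³}
    (hae : uncurry V =ᵐ[volume.restrict (Iio (0 : ℝ) ×ˢ (univ : Set ℝ³))] uncurry u)
    {lam : ℝ} (hlam : 0 < lam) :
    uncurry (nsRescale lam V) =ᵐ[volume.restrict (Iio (0 : ℝ) ×ˢ (univ : Set ℝ³))]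
      uncurry (nsRescale lam u) := by
  have hS := measurableSet_slabSet
  have hq := quasiMeasurePreserving_parabolicDilation hlam.ne'
  have hae' : ∀ᵐ z : ℝ × ℝ³ ∂volume, z ∈ Iio (0 : ℝ) ×ˢ (univ : Set ℝ³) → uncurry V z = uncurry u z :=
    (ae_restrict_iff' hS).1 hae
  refine (ae_restrict_iff' hS).2 ?_
  filter_upwards [hq.ae hae'] with z hz hzS
  have := hz ⟨show lam ^ 2 * z.1 < 0 from mul_neg_of_pos_of_neg (pow_pos hlam 2) hzS.1, mem_univ _⟩
  simp only [uncurry, nsRescale_apply] at this ⊢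
  rw [this]

/-- A.e. equality on the slab is transported by rotation-conjugation. -/
theorem ae_conj_congr {u V : ℝ → ℝ³ → ℝ³}
    (hae : uncurry V =ᵐ[volume.restrict (Iio (0 : ℝ) ×ˢ (univ : Set ℝ³))] uncurry u) (θ : ℝ) :
    uncurry (fun t x => rotZ θ (V t (rotZ (-θ) x)))
      =ᵐ[volume.restrict (Iio (0 : ℝ) ×ˢ (univ : Set ℝ³))]
      uncurry (fun t x => rotZ θ (u t (rotZ (-θ) x))) := by
  have hS := measurableSet_slabSet
  have hΦ := (SymmetricScarExists.ScarWindow.measurePreserving_prodMap_rotZIso (-θ)).quasiMeasurePreserving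
  have hae' : ∀ᵐ z : ℝ × ℝ³ ∂volume, z ∈ Iio (0 : ℝ) ×ˢ (univ : Set ℝ³) → uncurry V z = uncurry u z :=
    (ae_restrict_iff' hS).1 hae
  refine (ae_restrict_iff' hS).2 ?_
  filter_upwards [hΦ.ae hae'] with z hz hzS
  have := hz ⟨hzS.1, mem_univ _⟩
  simp only [uncurry, Prod.map, id, SymmetricScarExists.Negative.rotZIso_apply] at this ⊢
  rw [this]

/-- From a.e. equality of two fields continuous on the slab to equality on the slab. -/
theorem eq_on_slab_of_ae_eq {V W : ℝ → ℝ³ → ℝ³}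
    (hV : ContinuousOn (uncurry V) (Iio (0 : ℝ) ×ˢ (univ : Set ℝ³)))
    (hW : ContinuousOn (uncurry W) (Iio (0 : ℝ) ×ˢ (univ : Set ℝ³)))
    (hae : uncurry V =ᵐ[volume.restrict (Iio (0 : ℝ) ×ˢ (univ : Set ℝ³))] uncurry W) :
    ∀ t < 0, ∀ x : ℝ³, V t x = W t x := by
  intro t ht x
  have key := Measure.eqOn_open_of_ae_eq hae isOpen_slabSet hV hW
    (show ((t, x) : ℝ × ℝ³) ∈ Iio (0 : ℝ) ×ˢ (univ : Set ℝ³) from ⟨ht, mem_univ _⟩)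
  simpa using key

/-- **Scale-window ⇒ all scales** for EXACT self-similarity on the slab: if `λV(λ²t,λx) = V(t,x)` on the slab
for every `λ` in a neighbourhood of `1`, then for every `λ > 0` (the log-stabiliser is an open subgroup of the
connected group `ℝ`). -/
theorem selfSimilar_of_window {V : ℝ → ℝ³ → ℝ³} {δ : ℝ} (hδ : 0 < δ)
    (hwin : ∀ lam : ℝ, |lam - 1| < δ → 0 < lam → ∀ t < 0, ∀ x : ℝ³, nsRescale lam V t x = V t x) :
    ∀ lam : ℝ, 0 < lam → ∀ t < 0, ∀ x : ℝ³, nsRescale lam V t x = V t x := by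
  -- the stabiliser in log-scale
  let H : AddSubgroup ℝ :=
    { carrier := {a : ℝ | ∀ t < 0, ∀ x : ℝ³, nsRescale (Real.exp a) V t x = V t x}
      zero_mem' := by
        intro t _ x
        simp [nsRescale_apply]
      add_mem' := by
        intro a b ha hb t ht x
        have hea : 0 < Real.exp a := Real.exp_pos a
        have heb : 0 < Real.exp b := Real.exp_pos b
        have ht' : Real.exp b ^ 2 * t < 0 := mul_neg_of_pos_of_neg (pow_pos heb 2) ht
        have h1 := ha (Real.exp b ^ 2 * t) ht' (Real.exp b • x)
        have h2 := hb t ht x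
        simp only [nsRescale_apply] at h1 h2 ⊢
        rw [Real.exp_add, show (Real.exp a * Real.exp b) ^ 2 * t =
          Real.exp a ^ 2 * (Real.exp b ^ 2 * t) by ring, mul_comm (Real.exp a) (Real.exp b), mul_smul,
          mul_smul, smul_comm (Real.exp b) (Real.exp a) x, h1, h2]
      neg_mem' := by
        intro a ha t ht x
        have hea : 0 < Real.exp a := Real.exp_pos a
        have hena : 0 < Real.exp (-a) := Real.exp_pos (-a)
        have ht' : Real.exp (-a) ^ 2 * t < 0 := mul_neg_of_pos_of_neg (pow_pos hena 2) ht
        have h1 := ha (Real.exp (-a) ^ 2 * t) ht' (Real.exp (-a) • x)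
        simp only [nsRescale_apply] at h1 ⊢
        rw [smul_smul, ← mul_assoc, ← mul_pow, ← Real.exp_add, add_neg_cancel, Real.exp_zero,
          one_pow, one_mul, one_smul] at h1
        -- h1 : exp a • V t x = V (exp(-a)^2 t) (exp(-a) x)
        rw [← h1, smul_smul, ← Real.exp_add, neg_add_cancel, Real.exp_zero, one_smul] }
  have hH : ∀ a : ℝ, a ∈ (H : Set ℝ) ↔ ∀ t < 0, ∀ x : ℝ³, nsRescale (Real.exp a) V t x = V t x :=
    fun a => Iff.rfl
  -- it contains a neighbourhood of `0`
  have hcont : ContinuousAt (fun a : ℝ => |Real.exp a - 1|) 0 :=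
    ((Real.continuous_exp.sub continuous_const).abs).continuousAt
  have h0 : (fun a : ℝ => |Real.exp a - 1|) 0 < δ := by simpa using hδ
  have hnhds : (H : Set ℝ) ∈ 𝓝 (0 : ℝ) := by
    have hev : ∀ᶠ a in 𝓝 (0 : ℝ), |Real.exp a - 1| < δ := hcont.eventually (gt_mem_nhds h0)
    refine mem_of_superset hev fun a ha => ?_
    exact (hH a).2 (hwin _ ha (Real.exp_pos a))
  have hopen : IsOpen (H : Set ℝ) := H.isOpen_of_mem_nhds hnhds
  have huniv : (H : Set ℝ) = univ :=
    IsClopen.eq_univ ⟨H.isClosed_of_isOpen hopen, hopen⟩ ⟨0, H.zero_mem⟩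
  intro lam hlam
  have hmem : Real.log lam ∈ (H : Set ℝ) := huniv ▸ mem_univ _
  have := (hH _).1 hmem
  rwa [Real.exp_log hlam] at this

/-- **Angle-window ⇒ all angles** for EXACT axisymmetry on the slab. -/
theorem axisymmetric_of_window {V : ℝ → ℝ³ → ℝ³} {δ : ℝ} (hδ : 0 < δ)
    (hwin : ∀ θ : ℝ, |θ| < δ → ∀ t < 0, ∀ x : ℝ³, rotZ θ (V t (rotZ (-θ) x)) = V t x) :
    ∀ θ : ℝ, ∀ t < 0, ∀ x : ℝ³, rotZ θ (V t (rotZ (-θ) x)) = V t x := by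
  -- closure under addition
  have hadd : ∀ θ φ : ℝ, (∀ t < 0, ∀ x : ℝ³, rotZ θ (V t (rotZ (-θ) x)) = V t x) →
      (∀ t < 0, ∀ x : ℝ³, rotZ φ (V t (rotZ (-φ) x)) = V t x) →
      ∀ t < 0, ∀ x : ℝ³, rotZ (θ + φ) (V t (rotZ (-(θ + φ)) x)) = V t x := by
    intro θ φ hθ hφ t ht x
    have h1 := hφ t ht (rotZ (-θ) x)
    rw [rotZ_add, show -(θ + φ) = -φ + -θ by ring, rotZ_add, h1]
    exact hθ t ht x
  -- natural multiples of small angles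
  have hnsmul : ∀ (ψ : ℝ), |ψ| < δ → ∀ n : ℕ, ∀ t < 0, ∀ x : ℝ³,
      rotZ (n * ψ) (V t (rotZ (-(n * ψ)) x)) = V t x := by
    intro ψ hψ n
    induction n with
    | zero => intro t _ x; simp
    | succ n ih =>
      have := hadd (n * ψ) ψ ih (hwin ψ hψ)
      simpa [Nat.cast_succ, add_mul, one_mul] using this
  intro θ
  obtain ⟨n, hn⟩ := exists_nat_gt (|θ| / δ)
  have hnpos : (0 : ℝ) < n := lt_of_le_of_lt (div_nonneg (abs_nonneg θ) hδ.le) hn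
  have hψ : |θ / n| < δ := by
    rw [abs_div, abs_of_pos hnpos, div_lt_iff₀ hnpos]
    rw [div_lt_iff₀ hδ] at hn
    linarith [mul_comm δ (n : ℝ)]
  have h := hnsmul (θ / n) hψ n
  rwa [mul_div_cancel₀ _ hnpos.ne'] at h

end GeneratorHull

open GeneratorHull in
/-- **Registered tools stub of the glue** (`stub_generatorHullGlue`): the five transport/window lemmas above in one
conjunction. -/
theorem stub_generatorHullGlue :
    (∀ (u V : ℝ → ℝ³ → ℝ³),
      uncurry V =ᵐ[volume.restrict (Iio (0 : ℝ) ×ˢ (univ : Set ℝ³))] uncurry u → ∀ lam : ℝ, 0 < lam →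
      uncurry (nsRescale lam V) =ᵐ[volume.restrict (Iio (0 : ℝ) ×ˢ (univ : Set ℝ³))] uncurry (nsRescale lam u)) ∧
    (∀ (u V : ℝ → ℝ³ → ℝ³),
      uncurry V =ᵐ[volume.restrict (Iio (0 : ℝ) ×ˢ (univ : Set ℝ³))] uncurry u → ∀ θ : ℝ,
      uncurry (fun t x => rotZ θ (V t (rotZ (-θ) x))) =ᵐ[volume.restrict (Iio (0 : ℝ) ×ˢ (univ : Set ℝ³))]
        uncurry (fun t x => rotZ θ (u t (rotZ (-θ) x)))) ∧
    (∀ (V W : ℝ → ℝ³ → ℝ³), ContinuousOn (uncurry V) (Iio (0 : ℝ) ×ˢ (univ : Set ℝ³)) →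
      ContinuousOn (uncurry W) (Iio (0 : ℝ) ×ˢ (univ : Set ℝ³)) →
      uncurry V =ᵐ[volume.restrict (Iio (0 : ℝ) ×ˢ (univ : Set ℝ³))] uncurry W → ∀ t < 0, ∀ x : ℝ³, V t x = W t x) ∧
    (∀ (V : ℝ → ℝ³ → ℝ³) (δ : ℝ), 0 < δ →
      (∀ lam : ℝ, |lam - 1| < δ → 0 < lam → ∀ t < 0, ∀ x : ℝ³, nsRescale lam V t x = V t x) →
      ∀ lam : ℝ, 0 < lam → ∀ t < 0, ∀ x : ℝ³, nsRescale lam V t x = V t x) ∧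
    (∀ (V : ℝ → ℝ³ → ℝ³) (δ : ℝ), 0 < δ →
      (∀ θ : ℝ, |θ| < δ → ∀ t < 0, ∀ x : ℝ³, rotZ θ (V t (rotZ (-θ) x)) = V t x) →
      ∀ θ : ℝ, ∀ t < 0, ∀ x : ℝ³, rotZ θ (V t (rotZ (-θ) x)) = V t x) :=
  ⟨fun _ _ hae _ hlam => ae_nsRescale_congr hae hlam, fun _ _ hae θ => ae_conj_congr hae θ,
    fun _ _ hV hW hae => eq_on_slab_of_ae_eq hV hW hae, fun _ _ hδ hwin => selfSimilar_of_window hδ hwin,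
    fun _ _ hδ hwin => axisymmetric_of_window hδ hwin⟩

end Summit.NavierStokesRegularity.NavierStokesRegularity.Theorems.RellichScarScarRigidity

end
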